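import Summits.ValiantsHypothesis.ValiantsHypothesis.Theorems.SymPencilSdcPerFourCellNineSevenSplit
import Summits.ValiantsHypothesis.ValiantsHypothesis.Theorems.SymPencilPerFourSixDimCross
import Summits.ValiantsHypothesis.ValiantsHypothesis.Theorems.SymPencilPerFourIsotropicPairRank

/-!
# Route `SymPencil` — the CROSS branch of row `r = 9` of the size-`28` table: the full cross
# `X_{lc}` carries NO JOINT family of NINE squares (`--supports` stmt-ValiantsHypothesis-5674
# `SdcSuperquadratic`; (9,7) column; rung currency only — nothing here bears on `VP ≠ VNP`)

This is the statement `X979` pinned by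
`…CellNineSevenTwentyEight.false_of_rank_nine_le_twentyEight_of_crossNine`.  At size `27` the
cross branch died by a PER-DIRECTION count (`…CrossSevenEight`: fewer than `9` squares); at size
`28` the kernel carries `9` squares and the per-direction rank on the cross IS `9`, so the JOINT
structure is needed.  **Theorem** (`noJointNine_of_cross`): over a field of characteristic `0`, a
`7`-dimensional `V` inside a cross `X_{lc}` (hence equal to it) carries no `c : Fin 9 → K` and
bilinear `β_k` with `per_4 (u + s y) = e₀ + e₁ s + s² Σ_k c_k β_k(u,y)²` for all `u`, all `y ∈ V`.

PROOF (cross moved to `(3,3)` by `…JointFamilyTransport.jointFamily_map_prodCongr`).  `V = X₃₃`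
contains the column arm `y₁ = Σ_{i<3} E_{i3}` and the row arm `y₂ = Σ_{j<3} E_{3j}`.  For
`u = E(U)` supported on the `3 × 3` block: `per_4 (E U + s y₁) = 0` (zero last row),
`per_4 (E U + s y₂) = 0` (zero last column), `per_4 (E U + s (y₁ + y₂)) = s² q(U)` with
`q(U) = Σ_{i,j} per (U^{ij})`, whose polar form `(J − I) ⊗ (J − I)` is invertible
(`eq_zero_of_polar_q`).  Hence `Φ(U) = (β_k(E U, y₁))_k` and `Ψ(U) = (β_k(E U, y₂))_k` are
ISOTROPIC for `⟨v,w⟩ = Σ c_k v_k w_k` and their symmetrised pairing is non-degenerate on the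
`9`-dimensional block — impossible with `≤ 9` squares
(`…IsotropicPairRank.false_of_isotropic_pair_weights`: `rank Φ, rank Ψ ≤ 4`, `4 + 4 < 9`).

Honest framing: together with `…CellNineSevenTwentyEight` this closes row `r = 9` of the size-`28`
table; nothing about the determinantal complexity of `per_4` is claimed here; stmt-5674
`SdcSuperquadratic` OPEN; `VP ≠ VNP` not moved; no summit statement is proved.  No definitions,
no named facts. [folklore]
-/

noncomputable section

-- single-conjunct layout: Sub = Summit, duplicated namespace component intended
set_option linter.dupNamespace false

namespace Summit.ValiantsHypothesis.ValiantsHypothesis.Theorems.SymPencilPerFourCrossSevenNine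

open Matrix MvPolynomial Finset Module
open Literature.Computability.AlgebraicComplexity
open Summit.ValiantsHypothesis.ValiantsHypothesis.Theorems.SymPencilPerFourInnerRankRows
open Summit.ValiantsHypothesis.ValiantsHypothesis.Theorems.SymPencilPerFourJointFamilyTransport
open Summit.ValiantsHypothesis.ValiantsHypothesis.Theorems.SymPencilPerFourSixDimCross
open Summit.ValiantsHypothesis.ValiantsHypothesis.Theorems.SymPencilSdcPerFourCellNineSevenSplit
open Summit.ValiantsHypothesis.ValiantsHypothesis.Theorems.SymPencilPerFourIsotropicPairRank

universe u

variable {K : Type u} [Field K]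

/-- Polarization of a vanishing weighted sum of squares of linear maps. [folklore] -/
theorem polar_of_sq_eq_zero [CharZero K] {ι : Type*} [Fintype ι] {V : Type*} [AddCommGroup V]
    [Module K V] (c : ι → K) (F : V →ₗ[K] (ι → K)) (hF : ∀ u, ∑ k, c k * (F u k) ^ 2 = 0) :
    ∀ u u' : V, ∑ k, c k * F u k * F u' k = 0 := by
  intro u u'
  have h := hF (u + u')
  simp only [map_add, Pi.add_apply] at h
  have h2 : (2 : K) * ∑ k, c k * F u k * F u' k = 0 := by
    have e : (2 : K) * ∑ k, c k * F u k * F u' k =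
        ∑ k, c k * (F u k + F u' k) ^ 2 - ∑ k, c k * (F u k) ^ 2 - ∑ k, c k * (F u' k) ^ 2 := by
      rw [Finset.mul_sum, ← Finset.sum_sub_distrib, ← Finset.sum_sub_distrib]
      exact Finset.sum_congr rfl fun k _ => by ring
    rw [e, h, hF u, hF u']; ring
  exact (mul_eq_zero.1 h2).resolve_left two_ne_zero

/-- The `3 × 3`-block embedding `K⁹ → K^{4×4}` as a linear map. [folklore] -/
theorem exists_block_embedding :
    ∃ E : (Fin 9 → K) →ₗ[K] (Fin 4 × Fin 4 → K), ∀ (U : Fin 9 → K) (i j : Fin 4),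
      E U (i, j) = (![![U 0, U 1, U 2, 0], ![U 3, U 4, U 5, 0], ![U 6, U 7, U 8, 0], ![0, 0, 0, 0]] :
        Fin 4 → Fin 4 → K) i j :=
  ⟨{ toFun := fun U p => (![![U 0, U 1, U 2, 0], ![U 3, U 4, U 5, 0], ![U 6, U 7, U 8, 0], ![0, 0, 0, 0]] :
        Fin 4 → Fin 4 → K) p.1 p.2
     map_add' := fun U U' => by
       funext p; obtain ⟨i, j⟩ := p
       fin_cases i <;> fin_cases j <;> simp
     map_smul' := fun r U => by
       funext p; obtain ⟨i, j⟩ := p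
       fin_cases i <;> fin_cases j <;> simp }, fun _ _ _ => rfl⟩

/-- A `7`-dimensional subspace of the cross `X₃₃` is the whole cross: it contains every unit
matrix of the cross (cf. `…CrossSevenEight`). [folklore] -/
theorem single_mem_of_cross33 (V : Submodule K (Fin 4 × Fin 4 → K))
    (hX : ∀ x ∈ V, ∀ i j : Fin 4, i ≠ 3 → j ≠ 3 → x (i, j) = 0) (h7 : finrank K V = 7)
    (p : Fin 4 × Fin 4) (hp : p.1 = 3 ∨ p.2 = 3) :
    (Pi.single p (1 : K) : Fin 4 × Fin 4 → K) ∈ V := by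
  classical
  set T : Finset (Fin 4 × Fin 4) := Finset.univ.filter fun p : Fin 4 × Fin 4 => p.1 = 3 ∨ p.2 = 3
    with hTdef
  set C : Submodule K (Fin 4 × Fin 4 → K) :=
    Submodule.span K ↑(T.image fun p => (Pi.single p (1 : K) : Fin 4 × Fin 4 → K)) with hCdef
  have hCle : finrank K C ≤ 7 := by
    rw [hCdef]
    exact (finrank_span_finset_le_card _).trans
      (Finset.card_image_le.trans (by rw [hTdef, crossCells_card]))
  have hVC : V ≤ C := by
    intro y hy
    have hy0 : ∀ p, p ∉ T → y p = 0 := by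
      intro p hp
      rw [hTdef, Finset.mem_filter] at hp
      push Not at hp
      have hnc := hp (Finset.mem_univ _)
      exact hX y hy p.1 p.2 hnc.1 hnc.2
    have hdecomp : y = ∑ p ∈ T, y p • (Pi.single p (1 : K) : Fin 4 × Fin 4 → K) :=
      calc y = ∑ p, (Pi.single p (y p) : Fin 4 × Fin 4 → K) := (Finset.univ_sum_single y).symm
        _ = ∑ p ∈ T, (Pi.single p (y p) : Fin 4 × Fin 4 → K) := by
          symm
          refine Finset.sum_subset (Finset.subset_univ T) fun p _ hp => ?_
          rw [hy0 p hp, Pi.single_zero]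
        _ = ∑ p ∈ T, y p • (Pi.single p (1 : K) : Fin 4 × Fin 4 → K) :=
          Finset.sum_congr rfl fun p _ => by
            ext p'
            by_cases hp : p' = p
            · subst hp; simp
            · simp [hp]
    rw [hdecomp]
    exact Submodule.sum_mem _ fun p hp => Submodule.smul_mem _ _
      (Submodule.subset_span (Finset.mem_coe.2 (Finset.mem_image_of_mem _ hp)))
  have hVeq : V = C := Submodule.eq_of_le_of_finrank_le hVC (hCle.trans h7.ge)
  have hpT : p ∈ T := by rw [hTdef, Finset.mem_filter]; exact ⟨Finset.mem_univ _, hp⟩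
  rw [hVeq, hCdef]
  exact Submodule.subset_span (Finset.mem_coe.2 (Finset.mem_image_of_mem _ hpT))

/-- Block plus a multiple of the column arm: zero last row, permanent `0`. [folklore] -/
theorem per_block_colArm (U : Fin 9 → K) (s : K) :
    (Matrix.of ![![U 0, U 1, U 2, s], ![U 3, U 4, U 5, s], ![U 6, U 7, U 8, s],
      ![0, 0, 0, 0]]).permanent = 0 := by
  rw [permanent_of_rows]; simp

/-- Block plus a multiple of the row arm: zero last column, permanent `0`. [folklore] -/
theorem per_block_rowArm (U : Fin 9 → K) (s : K) :
    (Matrix.of ![![U 0, U 1, U 2, 0], ![U 3, U 4, U 5, 0], ![U 6, U 7, U 8, 0],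
      ![s, s, s, 0]]).permanent = 0 := by
  rw [permanent_of_rows]; simp

/-- Block plus a multiple of the hook: permanent `s² · Σ_{i,j} per (U^{ij})`. [folklore] -/
theorem per_block_hook (U : Fin 9 → K) (s : K) :
    (Matrix.of ![![U 0, U 1, U 2, s], ![U 3, U 4, U 5, s], ![U 6, U 7, U 8, s],
      ![s, s, s, 0]]).permanent = s ^ 2 * (
      (U 4 * U 8 + U 5 * U 7) +
      (U 3 * U 8 + U 5 * U 6) +
      (U 3 * U 7 + U 4 * U 6) +
      (U 1 * U 8 + U 2 * U 7) +
      (U 0 * U 8 + U 2 * U 6) +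
      (U 0 * U 7 + U 1 * U 6) +
      (U 1 * U 5 + U 2 * U 4) +
      (U 0 * U 5 + U 2 * U 3) +
      (U 0 * U 4 + U 1 * U 3)) := by
  rw [permanent_of_rows]
  simp only [Matrix.cons_val_zero, Matrix.cons_val_one, Matrix.cons_val]
  ring

/-- The polar form of `q(U) = Σ_{i,j} per (U^{ij})` against the nine unit vectors. [folklore] -/
theorem polar_q_singles (q : (Fin 9 → K) → K) (hq : ∀ U : Fin 9 → K, q U =
      (U 4 * U 8 + U 5 * U 7) +
      (U 3 * U 8 + U 5 * U 6) +
      (U 3 * U 7 + U 4 * U 6) +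
      (U 1 * U 8 + U 2 * U 7) +
      (U 0 * U 8 + U 2 * U 6) +
      (U 0 * U 7 + U 1 * U 6) +
      (U 1 * U 5 + U 2 * U 4) +
      (U 0 * U 5 + U 2 * U 3) +
      (U 0 * U 4 + U 1 * U 3))
    (U : Fin 9 → K) :
    q (U + Pi.single (0 : Fin 9) 1) - q U - q (Pi.single (0 : Fin 9) 1) = U 4 + U 5 + U 7 + U 8 ∧
    q (U + Pi.single (1 : Fin 9) 1) - q U - q (Pi.single (1 : Fin 9) 1) = U 3 + U 5 + U 6 + U 8 ∧
    q (U + Pi.single (2 : Fin 9) 1) - q U - q (Pi.single (2 : Fin 9) 1) = U 3 + U 4 + U 6 + U 7 ∧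
    q (U + Pi.single (3 : Fin 9) 1) - q U - q (Pi.single (3 : Fin 9) 1) = U 1 + U 2 + U 7 + U 8 ∧
    q (U + Pi.single (4 : Fin 9) 1) - q U - q (Pi.single (4 : Fin 9) 1) = U 0 + U 2 + U 6 + U 8 ∧
    q (U + Pi.single (5 : Fin 9) 1) - q U - q (Pi.single (5 : Fin 9) 1) = U 0 + U 1 + U 6 + U 7 ∧
    q (U + Pi.single (6 : Fin 9) 1) - q U - q (Pi.single (6 : Fin 9) 1) = U 1 + U 2 + U 4 + U 5 ∧
    q (U + Pi.single (7 : Fin 9) 1) - q U - q (Pi.single (7 : Fin 9) 1) = U 0 + U 2 + U 3 + U 5 ∧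
    q (U + Pi.single (8 : Fin 9) 1) - q U - q (Pi.single (8 : Fin 9) 1) = U 0 + U 1 + U 3 + U 4 := by
  refine ⟨?_, ?_, ?_, ?_, ?_, ?_, ?_, ?_, ?_⟩ <;>
    simp +decide only [hq, Pi.add_apply, Pi.single_apply, if_true, if_false, add_zero, mul_zero,
      mul_one] <;> ring

/-- The polar form of `q` is non-degenerate on the block (`(J − I) ⊗ (J − I)` is invertible).
[folklore] -/
theorem eq_zero_of_polar_q [CharZero K] (q : (Fin 9 → K) → K) (hq : ∀ U : Fin 9 → K, q U =
      (U 4 * U 8 + U 5 * U 7) +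
      (U 3 * U 8 + U 5 * U 6) +
      (U 3 * U 7 + U 4 * U 6) +
      (U 1 * U 8 + U 2 * U 7) +
      (U 0 * U 8 + U 2 * U 6) +
      (U 0 * U 7 + U 1 * U 6) +
      (U 1 * U 5 + U 2 * U 4) +
      (U 0 * U 5 + U 2 * U 3) +
      (U 0 * U 4 + U 1 * U 3))
    (U : Fin 9 → K) (h : ∀ p : Fin 9, q (U + Pi.single p 1) - q U - q (Pi.single p 1) = 0) :
    U = 0 := by
  obtain ⟨g0, g1, g2, g3, g4, g5, g6, g7, g8⟩ := polar_q_singles q hq U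
  rw [h] at g0 g1 g2 g3 g4 g5 g6 g7 g8
  have nine : ∀ p : Fin 9, p = 0 ∨ p = 1 ∨ p = 2 ∨ p = 3 ∨ p = 4 ∨ p = 5 ∨ p = 6 ∨ p = 7 ∨ p = 8 := by
    decide
  funext p
  rw [Pi.zero_apply]
  rcases nine p with rfl | rfl | rfl | rfl | rfl | rfl | rfl | rfl | rfl
  · have h4 : (4 : K) * U 0 = 0 := by linear_combination (-1 : K) * (g0 - g1 - g2 - g3 + g4 + g5 - g6 + g7 + g8)
    exact (mul_eq_zero.1 h4).resolve_left (by norm_num)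
  · have h4 : (4 : K) * U 1 = 0 := by linear_combination (-1 : K) * (-g0 + g1 - g2 + g3 - g4 + g5 + g6 - g7 + g8)
    exact (mul_eq_zero.1 h4).resolve_left (by norm_num)
  · have h4 : (4 : K) * U 2 = 0 := by linear_combination (-1 : K) * (-g0 - g1 + g2 + g3 + g4 - g5 + g6 + g7 - g8)
    exact (mul_eq_zero.1 h4).resolve_left (by norm_num)
  · have h4 : (4 : K) * U 3 = 0 := by linear_combination (-1 : K) * (-g0 + g1 + g2 + g3 - g4 - g5 - g6 + g7 + g8)
    exact (mul_eq_zero.1 h4).resolve_left (by norm_num)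
  · have h4 : (4 : K) * U 4 = 0 := by linear_combination (-1 : K) * (g0 - g1 + g2 - g3 + g4 - g5 + g6 - g7 + g8)
    exact (mul_eq_zero.1 h4).resolve_left (by norm_num)
  · have h4 : (4 : K) * U 5 = 0 := by linear_combination (-1 : K) * (g0 + g1 - g2 - g3 - g4 + g5 + g6 + g7 - g8)
    exact (mul_eq_zero.1 h4).resolve_left (by norm_num)
  · have h4 : (4 : K) * U 6 = 0 := by linear_combination (-1 : K) * (-g0 + g1 + g2 - g3 + g4 + g5 + g6 - g7 - g8)
    exact (mul_eq_zero.1 h4).resolve_left (by norm_num)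
  · have h4 : (4 : K) * U 7 = 0 := by linear_combination (-1 : K) * (g0 - g1 + g2 + g3 - g4 + g5 - g6 + g7 - g8)
    exact (mul_eq_zero.1 h4).resolve_left (by norm_num)
  · have h4 : (4 : K) * U 8 = 0 := by linear_combination (-1 : K) * (g0 + g1 - g2 + g3 + g4 - g5 - g6 - g7 + g8)
    exact (mul_eq_zero.1 h4).resolve_left (by norm_num)

/-- The three permanents along the arms and the hook, for the block embedding. [folklore] -/
theorem eval_block_arms (E : (Fin 9 → K) →ₗ[K] (Fin 4 × Fin 4 → K))
    (hE : ∀ (U : Fin 9 → K) (i j : Fin 4), E U (i, j) = (![![U 0, U 1, U 2, 0], ![U 3, U 4, U 5, 0], ![U 6, U 7, U 8, 0], ![0, 0, 0, 0]] :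
        Fin 4 → Fin 4 → K) i j)
    (y₁ y₂ : Fin 4 × Fin 4 → K) (ey₁ : ∀ i j : Fin 4, y₁ (i, j) = if j = 3 ∧ i ≠ 3 then (1 : K) else 0)
    (ey₂ : ∀ i j : Fin 4, y₂ (i, j) = if i = 3 ∧ j ≠ 3 then (1 : K) else 0)
    (q : (Fin 9 → K) → K) (hq : ∀ U : Fin 9 → K, q U =
      (U 4 * U 8 + U 5 * U 7) +
      (U 3 * U 8 + U 5 * U 6) +
      (U 3 * U 7 + U 4 * U 6) +
      (U 1 * U 8 + U 2 * U 7) +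
      (U 0 * U 8 + U 2 * U 6) +
      (U 0 * U 7 + U 1 * U 6) +
      (U 1 * U 5 + U 2 * U 4) +
      (U 0 * U 5 + U 2 * U 3) +
      (U 0 * U 4 + U 1 * U 3))
    (U : Fin 9 → K) (s : K) :
    eval (E U + s • y₁) (perPoly (Fin 4) K) = 0 ∧ eval (E U + s • y₂) (perPoly (Fin 4) K) = 0 ∧
      eval (E U + s • (y₁ + y₂)) (perPoly (Fin 4) K) = s ^ 2 * q U := by
  refine ⟨?_, ?_, ?_⟩
  · rw [eval_perPoly, ← per_block_colArm U s]
    congr 1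
    ext i j
    fin_cases i <;> fin_cases j <;> simp +decide [hE, ey₁]
  · rw [eval_perPoly, ← per_block_rowArm U s]
    congr 1
    ext i j
    fin_cases i <;> fin_cases j <;> simp +decide [hE, ey₂]
  · rw [eval_perPoly, hq, ← per_block_hook U s]
    congr 1
    ext i j
    fin_cases i <;> fin_cases j <;> simp +decide [hE, ey₁, ey₂]

/-- **The cross `X₃₃` carries no joint family of nine squares.** [folklore] -/
theorem noJointNine_of_cross33 [CharZero K] (V : Submodule K (Fin 4 × Fin 4 → K))
    (hX : ∀ x ∈ V, ∀ i j : Fin 4, i ≠ 3 → j ≠ 3 → x (i, j) = 0) (h7 : finrank K V = 7)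
    (c : Fin 9 → K) (β : Fin 9 → ((Fin 4 × Fin 4 → K) →ₗ[K] (Fin 4 × Fin 4 → K) →ₗ[K] K))
    (hfam : ∀ u : Fin 4 × Fin 4 → K, ∀ y ∈ V, ∃ e₀ e₁ : K, ∀ s : K,
      eval (u + s • y) (perPoly (Fin 4) K) = e₀ + s * e₁ + s ^ 2 * ∑ k, c k * (β k u y) ^ 2) :
    False := by
  classical
  have hunit := single_mem_of_cross33 V hX h7
  -- the two arms
  obtain ⟨y₁, hy₁⟩ : ∃ y₁ : Fin 4 × Fin 4 → K, y₁ = (Pi.single ((0 : Fin 4), (3 : Fin 4)) 1 +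
      Pi.single ((1 : Fin 4), (3 : Fin 4)) 1 + Pi.single ((2 : Fin 4), (3 : Fin 4)) 1) := ⟨_, rfl⟩
  obtain ⟨y₂, hy₂⟩ : ∃ y₂ : Fin 4 × Fin 4 → K, y₂ = (Pi.single ((3 : Fin 4), (0 : Fin 4)) 1 +
      Pi.single ((3 : Fin 4), (1 : Fin 4)) 1 + Pi.single ((3 : Fin 4), (2 : Fin 4)) 1) := ⟨_, rfl⟩
  have hy₁V : y₁ ∈ V := by
    rw [hy₁]
    exact V.add_mem (V.add_mem (hunit _ (Or.inr rfl)) (hunit _ (Or.inr rfl))) (hunit _ (Or.inr rfl))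
  have hy₂V : y₂ ∈ V := by
    rw [hy₂]
    exact V.add_mem (V.add_mem (hunit _ (Or.inl rfl)) (hunit _ (Or.inl rfl))) (hunit _ (Or.inl rfl))
  have hy₁₂V : y₁ + y₂ ∈ V := V.add_mem hy₁V hy₂V
  have ey₁ : ∀ i j : Fin 4, y₁ (i, j) = if j = 3 ∧ i ≠ 3 then (1 : K) else 0 := by
    intro i j; rw [hy₁]
    fin_cases i <;> fin_cases j <;> simp +decide
  have ey₂ : ∀ i j : Fin 4, y₂ (i, j) = if i = 3 ∧ j ≠ 3 then (1 : K) else 0 := by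
    intro i j; rw [hy₂]
    fin_cases i <;> fin_cases j <;> simp +decide
  -- the block embedding, `q`, and the three permanents
  obtain ⟨E, hE⟩ := exists_block_embedding (K := K)
  obtain ⟨q, hq⟩ : ∃ q : (Fin 9 → K) → K, ∀ U, q U =
      (U 4 * U 8 + U 5 * U 7) +
      (U 3 * U 8 + U 5 * U 6) +
      (U 3 * U 7 + U 4 * U 6) +
      (U 1 * U 8 + U 2 * U 7) +
      (U 0 * U 8 + U 2 * U 6) +
      (U 0 * U 7 + U 1 * U 6) +
      (U 1 * U 5 + U 2 * U 4) +
      (U 0 * U 5 + U 2 * U 3) +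
      (U 0 * U 4 + U 1 * U 3) := ⟨fun U => _, fun U => rfl⟩
  have hP := eval_block_arms E hE y₁ y₂ ey₁ ey₂ q hq
  -- the two isotropic maps
  obtain ⟨Φ, hΦ⟩ : ∃ Φ : (Fin 9 → K) →ₗ[K] (Fin 9 → K), ∀ U k, Φ U k = β k (E U) y₁ :=
    ⟨LinearMap.pi fun k => ((β k).flip y₁) ∘ₗ E, fun U k => rfl⟩
  obtain ⟨Ψ, hΨ⟩ : ∃ Ψ : (Fin 9 → K) →ₗ[K] (Fin 9 → K), ∀ U k, Ψ U k = β k (E U) y₂ :=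
    ⟨LinearMap.pi fun k => ((β k).flip y₂) ∘ₗ E, fun U k => rfl⟩
  have sq1 : ∀ U, ∑ k, c k * (Φ U k) ^ 2 = 0 := by
    intro U
    obtain ⟨e₀, e₁, he⟩ := hfam (E U) y₁ hy₁V
    have hz := quartic_coeffs_eq_zero e₀ e₁ (∑ k, c k * (β k (E U) y₁) ^ 2) 0 0 fun s => by
      have h := he s; rw [(hP U s).1] at h; linear_combination -h
    simp only [hΦ]; exact hz.2.2.1
  have sq2 : ∀ U, ∑ k, c k * (Ψ U k) ^ 2 = 0 := by
    intro U
    obtain ⟨e₀, e₁, he⟩ := hfam (E U) y₂ hy₂V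
    have hz := quartic_coeffs_eq_zero e₀ e₁ (∑ k, c k * (β k (E U) y₂) ^ 2) 0 0 fun s => by
      have h := he s; rw [(hP U s).2.1] at h; linear_combination -h
    simp only [hΨ]; exact hz.2.2.1
  have sq3 : ∀ U, ∑ k, c k * (Φ U k + Ψ U k) ^ 2 = q U := by
    intro U
    obtain ⟨e₀, e₁, he⟩ := hfam (E U) (y₁ + y₂) hy₁₂V
    have hz := quartic_coeffs_eq_zero e₀ e₁ (∑ k, c k * (β k (E U) (y₁ + y₂)) ^ 2 - q U) 0 0
      fun s => by
        have h := he s; rw [(hP U s).2.2] at h; linear_combination -h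
    have h3 := hz.2.2.1
    simp only [hΦ, hΨ, ← map_add]
    exact sub_eq_zero.1 h3
  have isoΦ := polar_of_sq_eq_zero c Φ sq1
  have isoΨ := polar_of_sq_eq_zero c Ψ sq2
  -- the symmetrised pairing and its polar identity
  obtain ⟨b, hb⟩ : ∃ b : (Fin 9 → K) → (Fin 9 → K) → K,
      ∀ U U', b U U' = ∑ k, c k * (Φ U k * Ψ U' k + Ψ U k * Φ U' k) :=
    ⟨fun U U' => _, fun _ _ => rfl⟩
  have key : ∀ U U', q (U + U') - q U - q U' = 2 * b U U' := by
    intro U U'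
    rw [← sq3, ← sq3, ← sq3, hb]
    simp only [map_add, Pi.add_apply]
    have e : ∑ k, c k * (Φ U k + Φ U' k + (Ψ U k + Ψ U' k)) ^ 2 -
        ∑ k, c k * (Φ U k + Ψ U k) ^ 2 - ∑ k, c k * (Φ U' k + Ψ U' k) ^ 2 =
        2 * ∑ k, c k * Φ U k * Φ U' k + 2 * ∑ k, c k * Ψ U k * Ψ U' k +
          2 * ∑ k, c k * (Φ U k * Ψ U' k + Ψ U k * Φ U' k) := by
      rw [Finset.mul_sum, Finset.mul_sum, Finset.mul_sum, ← Finset.sum_sub_distrib,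
        ← Finset.sum_sub_distrib, ← Finset.sum_add_distrib, ← Finset.sum_add_distrib]
      exact Finset.sum_congr rfl fun k _ => by ring
    rw [e, isoΦ, isoΨ]; ring
  -- non-degeneracy and the rank contradiction
  have hnd : ∀ U : Fin 9 → K, (∀ U', b U U' = 0) → U = 0 := fun U hU =>
    eq_zero_of_polar_q q hq U fun p => by rw [key, hU, mul_zero]
  exact false_of_isotropic_pair_weights (ι := Fin 9) (by simp) (by simp) c Φ Ψ isoΦ isoΨ b hb hnd

/-- ★ **X979 — a `7`-dimensional `V` inside a cross `X_{lc}` carries no joint family of nine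
squares** (transport to `(3,3)` by `jointFamily_map_prodCongr`). [folklore] -/
theorem noJointNine_of_cross [CharZero K] :
    ∀ V : Submodule K (Fin 4 × Fin 4 → K),
      (∃ l c : Fin 4, ∀ x ∈ V, ∀ i j : Fin 4, i ≠ l → j ≠ c → x (i, j) = 0) → finrank K V = 7 →
      ∀ (c : Fin 9 → K) (β : Fin 9 → ((Fin 4 × Fin 4 → K) →ₗ[K] (Fin 4 × Fin 4 → K) →ₗ[K] K)),
      ¬ (∀ u : Fin 4 × Fin 4 → K, ∀ y ∈ V, ∃ e₀ e₁ : K, ∀ s : K,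
      eval (u + s • y) (perPoly (Fin 4) K) = e₀ + s * e₁ + s ^ 2 * ∑ k, c k * (β k u y) ^ 2) := by
  rintro V ⟨l, c₀, hX⟩ h7 c β hfam
  set σ : Equiv.Perm (Fin 4) := Equiv.swap 3 l with hσ
  set τ : Equiv.Perm (Fin 4) := Equiv.swap 3 c₀ with hτ
  set Φ : (Fin 4 × Fin 4 → K) ≃ₗ[K] (Fin 4 × Fin 4 → K) :=
    LinearEquiv.funCongrLeft K K (Equiv.prodCongr σ τ) with hΦ
  have hΦa : ∀ (x : Fin 4 × Fin 4 → K) (i j : Fin 4), Φ x (i, j) = x (σ i, τ j) := fun x i j => rfl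
  obtain ⟨c', β', hfam'⟩ := jointFamily_map_prodCongr V σ τ c β hfam
  set V' := V.map Φ.toLinearMap with hV'def
  have hfin : finrank K V' = 7 := by rw [hV'def, LinearEquiv.finrank_map_eq, h7]
  have hX' : ∀ x ∈ V', ∀ i j : Fin 4, i ≠ 3 → j ≠ 3 → x (i, j) = 0 := by
    rintro _ ⟨x, hx, rfl⟩ i j hi hj
    show Φ x (i, j) = 0
    rw [hΦa]
    refine hX x hx (σ i) (τ j) (fun h => hi ?_) (fun h => hj ?_)
    · rw [hσ, Equiv.swap_apply_eq_iff, Equiv.swap_apply_right] at h; exact h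
    · rw [hτ, Equiv.swap_apply_eq_iff, Equiv.swap_apply_right] at h; exact h
  exact noJointNine_of_cross33 V' hX' hfin c' β' hfam'

end Summit.ValiantsHypothesis.ValiantsHypothesis.Theorems.SymPencilPerFourCrossSevenNine

end
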